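import Summits.MatrixMultiplication.MatrixMultiplication.Theorems.SaturationLadderXPerfectFamily

/-!
# Level-1 rectangular `CW_q` bound, all six patterns — I: the law and the free diagonal (route `SaturationLadder`, lens 1, gen 20)

Decomposition cell `decomp-mm`, lens 1 (grading / quantitative ladder), generation 20 — the
critic-endorsed move N6 ("type layer T, level 1 first") in its general form.  The lineage typed the
first-power `CW_q` laser method for the two-parameter X-perfect joint types on the FOUR patterns
`(1,1,0), (0,1,1), (1,0,1), (2,0,0)` (`SaturationLadderXPerfectEntropy/Family.lean`).  This file and its
two sequels (`…LevelOneEntropy.lean`, `…LevelOne.lean`) type it for an ARBITRARY joint type on all SIX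
patterns of `CW_q = ∑_{i+j+l=2} T_{ijl}`:
`Q = M · (n₁, …, n₆)` on `(1,1,0), (0,1,1), (1,0,1), (2,0,0), (0,2,0), (0,0,2)`, `N = M N₀`, `M = (q+2) m`.

Contents of part I (no definitions, no named facts, no sorry):
* §1 the six-pattern law: closed-form marginals (`marginalDist_six`), **marginal rigidity**
  `D(P) = {P}` on the support `{i+j+l = 2}` (`eq_of_mem_sameMarginalsOn_six`: the level-`2` marginal
  entries fix the corner patterns, then each matrix pattern is read off one level-`0` entry) and hence
  **zero penalty** `Γ_S(P) ≤ 0` for EVERY law on the six patterns (`maxEntropyPenalty_six_nonpos`; the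
  general form of the lineage's `maxEntropyPenalty_fam_nonpos`);
* §2 the combinatorial layer `sixDiagonalRaw`: a free diagonal `Δ` of triples of level words of joint
  type `Q`, coordinatewise in `cwSupport₃`, with the matrix-pattern counts `M n₁, M n₂, M n₃`, and
  `2^{N (min_m H(P_m) − Γ_S(P))} ≤ |Δ| (N+1)^63 · 192 · exp(4 √(log 6 + N log 27))`
  (`exists_free_diagonal_jointType_card`; the proof of the lineage's `xpDiagonalRaw` with six patterns).

References: Coppersmith–Winograd 1990 §6 [CoppersmithWinograd1990]; Bürgisser–Clausen–Shokrollahi 1997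
§15.7–15.8 [BurgisserClausenShokrollahi1997]; Le Gall 2014 App. A [LeGall2014].
-/

set_option linter.dupNamespace false
-- (single-conjunct summit: the namespace repeats `MatrixMultiplication`)

noncomputable section

open Finset
open scoped BigOperators

namespace Summit.MatrixMultiplication.MatrixMultiplication.Theorems.SaturationLadderLevelOne

open Literature.Computability.AlgebraicComplexity
open Literature.Barriers.MatrixMultiplication
open Summit.MatrixMultiplication.MatrixMultiplication.Theorems.PerfectAmortisation
open Summit.MatrixMultiplication.MatrixMultiplication.Theorems.SaturationLadderExpSaturation

/-! ## §1 The six-pattern law: marginals, rigidity `D(P) = {P}`, zero penalty -/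

/-- The three marginals of a law on the six patterns of `CW_q`. [folklore] -/
theorem marginalDist_six {P : Fin 3 × Fin 3 × Fin 3 → ℝ} {p₁ p₂ p₃ p₄ p₅ p₆ : ℝ}
    (hP : ∀ s, P s = if s = (1, 1, 0) then p₁ else if s = (0, 1, 1) then p₂
      else if s = (1, 0, 1) then p₃ else if s = (2, 0, 0) then p₄
      else if s = (0, 2, 0) then p₅ else if s = (0, 0, 2) then p₆ else 0) :
    marginalDist₁ P = ![p₂ + p₅ + p₆, p₁ + p₃, p₄] ∧
      marginalDist₂ P = ![p₃ + p₄ + p₆, p₁ + p₂, p₅] ∧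
      marginalDist₃ P = ![p₁ + p₄ + p₅, p₂ + p₃, p₆] := by
  refine ⟨?_, ?_, ?_⟩ <;> funext i <;> fin_cases i <;>
    simp [marginalDist₁, marginalDist₂, marginalDist₃, Fin.sum_univ_three, hP] <;> ring

/-- The law vanishes off the support `{i + j + l = 2}`. [folklore] -/
theorem six_eq_zero_of_not_mem {P : Fin 3 × Fin 3 × Fin 3 → ℝ} {p₁ p₂ p₃ p₄ p₅ p₆ : ℝ}
    (hP : ∀ s, P s = if s = (1, 1, 0) then p₁ else if s = (0, 1, 1) then p₂
      else if s = (1, 0, 1) then p₃ else if s = (2, 0, 0) then p₄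
      else if s = (0, 2, 0) then p₅ else if s = (0, 0, 2) then p₆ else 0)
    {s : Fin 3 × Fin 3 × Fin 3} (hs : s ∉ cwSupport₃) : P s = 0 := by
  rw [mem_cwSupport₃_iff] at hs
  push Not at hs
  rw [hP]
  simp [hs.1, hs.2.1, hs.2.2.1, hs.2.2.2.1, hs.2.2.2.2.1, hs.2.2.2.2.2]

/-- **`D(P) = {P}` on the support of `CW_q`**: a distribution supported in `{i + j + l = 2}` is
determined by its three marginals — the level-`2` marginals fix the three corner patterns, and then
each matrix pattern is read off from one level-`0` marginal. [folklore] -/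
theorem eq_of_mem_sameMarginalsOn_six {P P' : Fin 3 × Fin 3 × Fin 3 → ℝ} {p₁ p₂ p₃ p₄ p₅ p₆ : ℝ}
    (hP : ∀ s, P s = if s = (1, 1, 0) then p₁ else if s = (0, 1, 1) then p₂
      else if s = (1, 0, 1) then p₃ else if s = (2, 0, 0) then p₄
      else if s = (0, 2, 0) then p₅ else if s = (0, 0, 2) then p₆ else 0)
    (hP' : P' ∈ sameMarginalsOn cwSupport₃ P) : P' = P := by
  obtain ⟨-, hoff, h₁, h₂, h₃⟩ := hP'
  obtain ⟨hm₁, hm₂, hm₃⟩ := marginalDist_six hP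
  have z : ∀ a b c : Fin 3, (a : ℕ) + b + c ≠ 2 → P' (a, b, c) = 0 := fun a b c h =>
    hoff _ (mt mem_cwSupport₃.1 h)
  have e₁ : marginalDist₁ P' 2 = p₄ := by rw [h₁, hm₁]; simp
  have e₂ : marginalDist₂ P' 2 = p₅ := by rw [h₂, hm₂]; simp
  have e₃ : marginalDist₃ P' 2 = p₆ := by rw [h₃, hm₃]; simp
  have f₁ : marginalDist₁ P' 0 = p₂ + p₅ + p₆ := by rw [h₁, hm₁]; simp
  have f₂ : marginalDist₂ P' 0 = p₃ + p₄ + p₆ := by rw [h₂, hm₂]; simp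
  have f₃ : marginalDist₃ P' 0 = p₁ + p₄ + p₅ := by rw [h₃, hm₃]; simp
  simp (disch := decide) only [marginalDist₁, marginalDist₂, marginalDist₃, Fin.sum_univ_three, z,
    add_zero, zero_add] at e₁ e₂ e₃ f₁ f₂ f₃
  have p011 : P' (0, 1, 1) = p₂ := by linarith
  have p101 : P' (1, 0, 1) = p₃ := by linarith
  have p110 : P' (1, 1, 0) = p₁ := by linarith
  funext s
  by_cases hs : s ∈ cwSupport₃
  · rw [hP]
    rw [mem_cwSupport₃_iff] at hs
    rcases hs with rfl | rfl | rfl | rfl | rfl | rfl <;> simp [p011, p101, p110, e₁, e₂, e₃]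
  · rw [hoff s hs, six_eq_zero_of_not_mem hP hs]

/-- **The penalty vanishes on `CW_q`'s support**: `Γ_S(P) = max_{D(P)} H − H(P) ≤ 0` for every
probability law on the six patterns. [folklore] -/
theorem maxEntropyPenalty_six_nonpos {P : Fin 3 × Fin 3 × Fin 3 → ℝ} {p₁ p₂ p₃ p₄ p₅ p₆ : ℝ}
    (hP : ∀ s, P s = if s = (1, 1, 0) then p₁ else if s = (0, 1, 1) then p₂
      else if s = (1, 0, 1) then p₃ else if s = (2, 0, 0) then p₄
      else if s = (0, 2, 0) then p₅ else if s = (0, 0, 2) then p₆ else 0)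
    (h₁ : 0 ≤ p₁) (h₂ : 0 ≤ p₂) (h₃ : 0 ≤ p₃) (h₄ : 0 ≤ p₄) (h₅ : 0 ≤ p₅) (h₆ : 0 ≤ p₆)
    (hsum : p₁ + p₂ + p₃ + p₄ + p₅ + p₆ = 1) :
    maxEntropyPenalty cwSupport₃ P ≤ 0 := by
  have hsimplex : P ∈ stdSimplex ℝ (Fin 3 × Fin 3 × Fin 3) := by
    refine ⟨fun s => ?_, ?_⟩
    · rw [hP]
      split_ifs <;> linarith
    · have hm := (marginalDist_six hP).1
      have e : ∑ s, P s = ∑ a, marginalDist₁ P a := by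
        rw [sum_triple_eq]
        simp [marginalDist₁]
      rw [e, hm, Fin.sum_univ_three]
      simp
      linarith
  have hsupp : ∀ s, s ∉ cwSupport₃ → P s = 0 := fun s hs => six_eq_zero_of_not_mem hP hs
  have hle : maxEntropyGivenMarginals cwSupport₃ P ≤ shannonEntropy P :=
    maxEntropyGivenMarginals_le ⟨P, self_mem_sameMarginalsOn hsimplex hsupp⟩
      fun P' hP' => (congrArg shannonEntropy (eq_of_mem_sameMarginalsOn_six hP hP')).le
  exact sub_nonpos.2 hle

/-! ## §2 Layer B1 — a large free diagonal of the joint type `M · (n₁,…,n₆)`, `N = (q+2) N₀ m`, `M = (q+2) m` -/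

/-- **Combinatorial layer (six patterns).** For counts `n₁,…,n₆` (`N₀ = ∑ nᵢ ≥ 1`), `m ≥ 1`,
`M = (q+2) m`, `N = (q+2) N₀ m` and `P = Q/N`, `Q = M · n` on the six patterns, there is a family `Δ`
of triples of level words, coordinatewise in `cwSupport₃`, with exactly `M n₁`, `M n₂`, `M n₃`
positions of pattern `(1,1,0)`, `(0,1,1)`, `(1,0,1)`, forming a free diagonal, with
`2^{N (min_m H(P_m) − Γ_S(P))} ≤ |Δ| · (N+1)^63 · 192 · exp(4 √(log 6 + N log 27))`
(`exists_free_diagonal_jointType_card`, `S = cwSupport₃`, `b = 2`, `G = 27`, `A = 9`; the proof of the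
lineage's `xpDiagonalRaw` with a six-pattern type). [cite: LeGall2014, Appendix A.3, Eq. (7) and p. 24] -/
theorem sixDiagonalRaw :
    ∀ q n₁ n₂ n₃ n₄ n₅ n₆ m : ℕ, 1 ≤ n₁ + n₂ + n₃ + n₄ + n₅ + n₆ → 1 ≤ m →
      ∀ P : Fin 3 × Fin 3 × Fin 3 → ℝ,
      (∀ s, P s = ((if s = (1, 1, 0) then (q + 2) * m * n₁ else if s = (0, 1, 1) then (q + 2) * m * n₂
          else if s = (1, 0, 1) then (q + 2) * m * n₃ else if s = (2, 0, 0) then (q + 2) * m * n₄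
          else if s = (0, 2, 0) then (q + 2) * m * n₅ else if s = (0, 0, 2) then (q + 2) * m * n₆
          else 0 : ℕ) : ℝ) / ((((q + 2) * (n₁ + n₂ + n₃ + n₄ + n₅ + n₆) * m : ℕ)) : ℝ)) →
      ∃ Δ : Finset ((Fin ((q + 2) * (n₁ + n₂ + n₃ + n₄ + n₅ + n₆) * m) → Fin 3) ×
          (Fin ((q + 2) * (n₁ + n₂ + n₃ + n₄ + n₅ + n₆) * m) → Fin 3) ×
          (Fin ((q + 2) * (n₁ + n₂ + n₃ + n₄ + n₅ + n₆) * m) → Fin 3)),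
        (∀ δ ∈ Δ, ∀ ρ, labelSeq δ ρ ∈ cwSupport₃) ∧
        (∀ δ ∈ Δ, letterCount (labelSeq δ) (1, 1, 0) = (q + 2) * m * n₁ ∧
          letterCount (labelSeq δ) (0, 1, 1) = (q + 2) * m * n₂ ∧
          letterCount (labelSeq δ) (1, 0, 1) = (q + 2) * m * n₃) ∧
        (∀ δ ∈ Δ, ∀ δ' ∈ Δ, ∀ δ'' ∈ Δ, (∀ ρ, (δ.1 ρ, δ'.2.1 ρ, δ''.2.2 ρ) ∈ cwSupport₃) →
          δ = δ' ∧ δ' = δ'') ∧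
        (2 : ℝ) ^ (((((q + 2) * (n₁ + n₂ + n₃ + n₄ + n₅ + n₆) * m : ℕ)) : ℝ) *
            (min (shannonEntropy (marginalDist₁ P))
              (min (shannonEntropy (marginalDist₂ P)) (shannonEntropy (marginalDist₃ P))) -
              maxEntropyPenalty cwSupport₃ P)) ≤
          (Δ.card : ℝ) * ((((((q + 2) * (n₁ + n₂ + n₃ + n₄ + n₅ + n₆) * m : ℕ)) : ℝ)) + 1) ^ 63 * 192 *
            Real.exp (4 * Real.sqrt (Real.log 6 +
              ((((q + 2) * (n₁ + n₂ + n₃ + n₄ + n₅ + n₆) * m : ℕ)) : ℝ) * Real.log 27)) := by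
  intro q n₁ n₂ n₃ n₄ n₅ n₆ m hN hm P hP
  classical
  -- tightness data of `cwSupport₃` (as in `bigCw_laser_inequality`)
  have hinj : Function.Injective fun (i : Fin 3) (_ : Fin 1) => (i : ℤ) := by
    intro i i' h
    have h0 := congrFun h 0
    simp only [Nat.cast_inj] at h0
    exact Fin.ext h0
  have hinjγ : Function.Injective fun (l : Fin 3) (_ : Fin 1) => (l : ℤ) - 2 := by
    intro l l' h
    have h0 := congrFun h 0
    simp only [sub_left_inj, Nat.cast_inj] at h0
    exact Fin.ext h0
  have hbd : ∀ (i : Fin 3) (ρ : Fin 1), |((fun (i : Fin 3) (_ : Fin 1) => (i : ℤ)) i ρ)| ≤ (2 : ℕ) := by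
    intro i ρ
    have := i.isLt
    simp only [Nat.cast_ofNat, Nat.abs_cast]
    omega
  have htight : ∀ s ∈ cwSupport₃, ∀ ρ : Fin 1,
      (fun (i : Fin 3) (_ : Fin 1) => (i : ℤ)) s.1 ρ + (fun (j : Fin 3) (_ : Fin 1) => (j : ℤ)) s.2.1 ρ +
        (fun (l : Fin 3) (_ : Fin 1) => (l : ℤ) - 2) s.2.2 ρ = 0 := by
    intro s hs ρ
    rw [mem_cwSupport₃] at hs
    simp only
    omega
  -- the joint type `Q = M · n` and `N = (q+2) N₀ m`
  obtain ⟨Q, hQdef⟩ : ∃ Q : Fin 3 × Fin 3 × Fin 3 → ℕ, Q = fun s =>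
      if s = (1, 1, 0) then (q + 2) * m * n₁ else if s = (0, 1, 1) then (q + 2) * m * n₂
      else if s = (1, 0, 1) then (q + 2) * m * n₃ else if s = (2, 0, 0) then (q + 2) * m * n₄
      else if s = (0, 2, 0) then (q + 2) * m * n₅ else if s = (0, 0, 2) then (q + 2) * m * n₆ else 0 :=
    ⟨_, rfl⟩
  have hN' : 0 < (q + 2) * (n₁ + n₂ + n₃ + n₄ + n₅ + n₆) * m :=
    Nat.mul_pos (Nat.mul_pos (by omega) (by omega)) (by omega)
  have hQS : ∀ s, s ∉ cwSupport₃ → Q s = 0 := by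
    intro s hs
    rw [mem_cwSupport₃_iff] at hs
    push Not at hs
    obtain ⟨h1, h2, h3, h4, h5, h6⟩ := hs
    simp [hQdef, h1, h2, h3, h4, h5, h6]
  have hsumQ : (q + 2) * m * n₁ + (q + 2) * m * n₂ + (q + 2) * m * n₃ + (q + 2) * m * n₄ +
      (q + 2) * m * n₅ + (q + 2) * m * n₆ = (q + 2) * (n₁ + n₂ + n₃ + n₄ + n₅ + n₆) * m := by ring
  have hQ : ∑ s, Q s = (q + 2) * (n₁ + n₂ + n₃ + n₄ + n₅ + n₆) * m := by
    rw [sum_triple_eq, hQdef, ← hsumQ]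
    simp [Fin.sum_univ_three]
    ring
  have hP' : ∀ s, P s = (Q s : ℝ) / ((((q + 2) * (n₁ + n₂ + n₃ + n₄ + n₅ + n₆) * m : ℕ)) : ℝ) := by
    intro s
    rw [hQdef]
    exact hP s
  -- the tree theorem
  obtain ⟨Δ, hΔQ, hfree, hsize⟩ := exists_free_diagonal_jointType_card cwSupport₃ (r := 1) (b := 2)
    (fun (i : Fin 3) (_ : Fin 1) => (i : ℤ)) (fun (j : Fin 3) (_ : Fin 1) => (j : ℤ))
    (fun (l : Fin 3) (_ : Fin 1) => (l : ℤ) - 2) hinj hinj hinjγ hbd hbd htight hN' Q hQS hQ P hP'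
  have hQδ : ∀ δ ∈ Δ, letterCount (labelSeq δ) = Q := fun δ hδ => (Finset.mem_filter.1 (hΔQ hδ)).2
  refine ⟨Δ, ?_, ?_, hfree, ?_⟩
  · -- coordinatewise support
    intro δ hδ ρ
    by_contra hρ
    have h0 := hQS _ hρ
    rw [← hQδ δ hδ] at h0
    exact (letterCount_pos_of_apply (labelSeq δ) ρ).ne' h0
  · -- the three letter counts
    intro δ hδ
    rw [hQδ δ hδ, hQdef]
    simp
  · -- the size bound, constants evaluated
    refine hsize.trans_eq ?_
    have hmax : (max 2 1 : ℕ) = 2 := by decide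
    generalize ((((q + 2) * (n₁ + n₂ + n₃ + n₄ + n₅ + n₆) * m : ℕ)) : ℝ) = Nr
    simp only [Fintype.card_prod, Fintype.card_fin, hmax]
    norm_num
    simp only [mul_assoc]

end Summit.MatrixMultiplication.MatrixMultiplication.Theorems.SaturationLadderLevelOne

end
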